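import Literature.Computability.QuantumComplexity.RestBlockStates
import Literature.Computability.Cryptography.QuantumCircuitProofs
import HarnessLib

/-!
# A gate on a block does not change the measurement statistics off the block

Topic `Literature/Computability/QuantumComplexity`; sequel of `RestBlockStates.lean` (`AgreeOff E z c`:
the registers `z`, `c` agree off the block `E : Fin b ↪ Fin W`; `sum_ite_agreeOff_eq_sum_extend`) and
`CircuitEmbedding.lean` (`placeGate_mulVec_apply`). **Idle-wire invariance** (Nielsen–Chuang 2010,
§2.2.8 with §2.4.3: operations on system `B` do not affect the measurement statistics of system `A`):
if a unitary `V` acts on the block `E` only (`placeGate E V`), then for every observable `f` of the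
measured register that does not read the block (`f z = f z'` whenever `AgreeOff E z z'`) the
push-forward of the Born law is unchanged,

  `(bornPMF (placeGate E V ψ)).map f = (bornPMF ψ).map f`   (`bornPMF_placeGate_map_eq`),

from the fibrewise identity `∑_{z : f z = y} |(placeGate E V ψ) z|² = ∑_{z : f z = y} |ψ z|²`
(`sum_ite_normSq_placeGate_eq`: on each fibre `{extend E g c : g}` the placed gate acts as `V` on the
block content, and `V` preserves `∑_g |·|²`); `bornPMF_toMatrix_mapWires_map_eq` is the circuit form
(a circuit transported onto the block by `mapWires`). In Regev's sampler (J. ACM 56 (2009), art. 34,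
Lemma 3.14) this lets the uniform one-copy machine carry registers for more coordinates than the
instance has: whatever the stages do on the unused registers does not affect the decoded output.

Everything is proved; no definition, no named fact is introduced.

## References

* M. A. Nielsen, I. L. Chuang, *Quantum Computation and Quantum Information*, CUP 2010, §2.2.8
  (measurement statistics of composite systems), §2.4.3 (reduced states), §4.3 [NielsenChuang2010].
* E. Bernstein, U. Vazirani, *Quantum complexity theory*, SIAM J. Comput. 26 (1997) 1411–1473, §8.2
  (extra work tape cells do not change the output distribution) [BernsteinVazirani1997].
* O. Regev, *On lattices, learning with errors, random linear codes, and cryptography*, J. ACM 56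
  (2009), art. 34, Lemma 3.14 (proof) [Regev2009].
-/

noncomputable section

open Matrix Finset

namespace Literature.Computability.QuantumComplexity

open Cryptography

variable {b W : ℕ} (E : Fin b ↪ Fin W)

open scoped Classical in
/-- **Fibrewise invariance**: for a unitary `V` placed on the block `E` and an observable `f` not reading
the block, `∑_{z : f z = y} |(placeGate E V ψ) z|² = ∑_{z : f z = y} |ψ z|²`.
[cite: NielsenChuang2010, §2.2.8, §4.3] -/
theorem sum_ite_normSq_placeGate_eq {V : Matrix (QReg b) (QReg b) ℂ} (hV : V ∈ Matrix.unitaryGroup (QReg b) ℂ)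
    (ψ : QReg W → ℂ) {β : Type*} (f : QReg W → β) (hf : ∀ z z', AgreeOff E z z' → f z = f z') (y : β) :
    (∑ z, if y = f z then ‖(placeGate E V *ᵥ ψ) z‖ ^ 2 else 0) = ∑ z, if y = f z then ‖ψ z‖ ^ 2 else 0 := by
  -- (A) summing a function over the register `2^b` times = summing it over all fibres `{extend E g c : g}`
  have hcnt : ∀ z : QReg W, (∑ c : QReg W, if AgreeOff E z c then (1 : ℝ) else 0) = (2 : ℝ) ^ b := by
    intro z
    have h1 : (∑ c : QReg W, if AgreeOff E z c then (1 : ℝ) else 0) = ∑ c : QReg W, if AgreeOff E c z then (1 : ℝ) else 0 :=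
      sum_congr rfl fun c _ => if_congr ⟨AgreeOff.symm E, AgreeOff.symm E⟩ rfl rfl
    rw [h1, sum_ite_agreeOff_eq_sum_extend E z (fun _ => (1 : ℝ)), sum_const, card_univ, nsmul_eq_mul, mul_one]
    simp [Fintype.card_pi]
  have hA : ∀ χ : QReg W → ℂ, (2 : ℝ) ^ b * (∑ z, if y = f z then ‖χ z‖ ^ 2 else 0) =
      ∑ c : QReg W, ∑ g : QReg b, (if y = f (Function.extend E g c) then ‖χ (Function.extend E g c)‖ ^ 2 else 0) := by
    intro χ
    calc (2 : ℝ) ^ b * (∑ z, if y = f z then ‖χ z‖ ^ 2 else 0)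
        = ∑ z, (if y = f z then ‖χ z‖ ^ 2 else 0) * ∑ c : QReg W, (if AgreeOff E z c then (1 : ℝ) else 0) := by
          rw [mul_comm, sum_mul]
          exact sum_congr rfl fun z _ => by rw [hcnt]
      _ = ∑ z, ∑ c : QReg W, (if AgreeOff E z c then (if y = f z then ‖χ z‖ ^ 2 else 0) else 0) := by
          refine sum_congr rfl fun z _ => ?_
          rw [mul_sum]
          exact sum_congr rfl fun c _ => by split_ifs <;> simp
      _ = ∑ c : QReg W, ∑ z, (if AgreeOff E z c then (if y = f z then ‖χ z‖ ^ 2 else 0) else 0) := sum_comm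
      _ = _ := sum_congr rfl fun c _ => sum_ite_agreeOff_eq_sum_extend E c _
  -- (B) on each fibre the placed gate acts as `V` on the block content, and `V` preserves `∑ |·|²`
  have hB : ∀ c : QReg W,
      (∑ g : QReg b, (if y = f (Function.extend E g c) then ‖(placeGate E V *ᵥ ψ) (Function.extend E g c)‖ ^ 2 else 0)) =
        ∑ g : QReg b, (if y = f (Function.extend E g c) then ‖ψ (Function.extend E g c)‖ ^ 2 else 0) := by
    intro c
    have hfc : ∀ g : QReg b, f (Function.extend E g c) = f c := fun g => hf _ _ (agreeOff_extend E g c)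
    simp_rw [hfc]
    by_cases hy : y = f c
    · simp only [if_pos hy]
      have hφu : ∀ g : QReg b, (placeGate E V *ᵥ ψ) (Function.extend E g c) =
          (V *ᵥ fun g' => ψ (Function.extend E g' c)) g := by
        intro g
        rw [placeGate_mulVec_apply]
        simp only [Matrix.mulVec, dotProduct]
        refine sum_congr rfl fun g' _ => ?_
        have h1 : Function.extend E g c ∘ E = g := funext fun i => E.injective.extend_apply g c i
        rw [h1, extend_extend]
      have hn := normSq_mulVec_of_mem_unitaryGroup hV (fun g' => ψ (Function.extend E g' c))
      unfold normSq at hn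
      simpa only [hφu] using hn
    · simp only [if_neg hy]
  have h2 : (2 : ℝ) ^ b ≠ 0 := by positivity
  refine mul_left_cancel₀ h2 ?_
  rw [hA, hA]
  exact sum_congr rfl fun c _ => hB c

open scoped Classical in
/-- **Idle-wire invariance of the measured law**: a unitary placed on the block `E`, applied to a unit
vector, does not change the push-forward of the Born law along any observable that does not read the
block. [cite: NielsenChuang2010, §2.2.8, §2.4.3] [cite: Regev2009, Lemma 3.14 (proof)] -/
theorem bornPMF_placeGate_map_eq {V : Matrix (QReg b) (QReg b) ℂ} (hV : V ∈ Matrix.unitaryGroup (QReg b) ℂ)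
    {ψ : QReg W → ℂ} (hψ : normSq ψ = 1) {β : Type*} (f : QReg W → β) (hf : ∀ z z', AgreeOff E z z' → f z = f z') :
    (bornPMF (placeGate E V *ᵥ ψ)).map f = (bornPMF ψ).map f := by
  have hφ : normSq (placeGate E V *ᵥ ψ) = 1 := by
    rw [normSq_mulVec_of_mem_unitaryGroup (placeGate_mem_unitaryGroup_holds E hV), hψ]
  have key : ∀ χ : QReg W → ℂ, normSq χ = 1 → ∀ y : β,
      (∑ z, if y = f z then bornPMF χ z else 0) = ENNReal.ofReal (∑ z, if y = f z then ‖χ z‖ ^ 2 else 0) := by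
    intro χ hχ y
    rw [ENNReal.ofReal_sum_of_nonneg (fun z _ => by split_ifs <;> positivity)]
    refine sum_congr rfl fun z _ => ?_
    split_ifs with h
    · exact bornPMF_apply_of_sum_eq_one hχ z
    · exact ENNReal.ofReal_zero.symm
  refine PMF.ext fun y => ?_
  rw [PMF.map_apply, PMF.map_apply, tsum_fintype, tsum_fintype, key _ hφ, key _ hψ,
    sum_ite_normSq_placeGate_eq E hV ψ f hf y]

open scoped Classical in
/-- Circuit form: a circuit transported onto the block by `mapWires` (its matrix being unitary) does not
change the measured law off the block. [cite: NielsenChuang2010, §2.2.8, §4.2] -/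
theorem bornPMF_toMatrix_mapWires_map_eq {G : QGateSet} (C : QCircuit G b) (A : Language Bool)
    (hC : C.toMatrix A ∈ Matrix.unitaryGroup (QReg b) ℂ) {ψ : QReg W → ℂ} (hψ : normSq ψ = 1) {β : Type*}
    (f : QReg W → β) (hf : ∀ z z', AgreeOff E z z' → f z = f z') :
    (bornPMF ((mapWires E C).toMatrix A *ᵥ ψ)).map f = (bornPMF ψ).map f := by
  rw [toMatrix_mapWires]
  exact bornPMF_placeGate_map_eq E hC hψ f hf

end Literature.Computability.QuantumComplexity

end
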